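import Mathlib
import Summits.NavierStokesRegularity.FluidComputer.AbcClassIISynthesis
import Summits.NavierStokesRegularity.FluidComputer.SkewCutGalerkinFromSectionsIcc
import Summits.NavierStokesRegularity.FluidComputer.SkewCutGalerkinWeights
import Summits.NavierStokesRegularity.FluidComputer.AbcLatticeEigenSynthesis

/-!
# Class-II layer of the skew-cut X0 chain, END-TO-END (closed bracket): Galerkin section eigenpairs of
# the MODEL operator in the orbit basis ⇒ a classical eigenvalue of the linearisation about the ABC flow
(instab4 g6 — implementation 2 of the skew-cut X0 certifier, cell `ns-blowup`, 2026-08-27)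

HONEST FRAMING (human ruling D-0035): nothing here is a claim about Navier–Stokes blow-up.
WHAT THIS IS NOT: not NS evidence. MODEL lane (Navier–Stokes linearised about the forced ABC flow
`U = abcFlow 1 1 1`, `f = νU`); no certificate, number or census word moves. This file COMPOSES the
kernel chain of `HOME/instab4/KERNEL-CHAIN.md` for the model operator in CARTESIAN family
coordinates with the EXISTENTIAL orbit-adapted class-II basis `bfam` (`AbcClassIIDefs` …
`AbcClassIISynthesis`, this seat) and the abstract chain (`SkewCutGalerkinFromSectionsIcc`,
`SkewCutGalerkinWeights`, instab3's `SkewCutGalerkinLattice`, instab4's `AbcLatticeEigenSynthesis`):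

**`isLinNSEigenvalue_of_section_eigenpairs`.** Let `R ≥ 1`, `x₁ ≤ x₂`, `K₀ ∈ ℕ`. Suppose that for every
`n` the REAL Galerkin section of the model operator `L_R = −(1/R)|k|² + Π X` on the class-II cube space
of level `K₀ + n` — the matrix `−(|O_i|²/R) δ_ij + amat i j` on `cubeIdx (K₀ + n)`, `amat` the real
first-order matrix in the orbit basis (`AbcClassIIDefs`) — has a normalised real eigenvector `v_n` with
eigenvalue `x_n ∈ [x₁, x₂]`, and the graph norms `Σ_j (1 + |O_j|²/R)² v_n(j)²` are bounded uniformly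
in `n`. Then there is `λ ∈ [x₁, x₂]` such that `2πλ` is an eigenvalue of the tree's linearised
Navier–Stokes operator about `Torus.abcFlow 1 1 1` on the unit torus with viscosity `1/(2πR)`:
`Torus.IsLinNSEigenvalue (1/(2πR)) (Torus.abcFlow 1 1 1) (2πλ)` (a smooth divergence-free mean-free
eigenfield with a smooth pressure) — the hypothesis of
`AbcLyapunovInstability.isLyapunovUnstable_abcFlow_of_eigenvalue` (rung R-α, conditional on FPS06).

The remaining inputs — section eigenpairs in `[x₁, x₂]` for every level `≥ K₀ + 1` and the uniform
graph bound — are EXACTLY what instab3's finite half of the certificate chain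
(`SkewCutSchurCoercivity.exists_eigenvalue_of_certificate`, `SkewCutGalerkinBounds`) produces from the
certificates' transcribed head signs / shell numbers / tail constants once the section matrices are
identified with these real matrices (the `AbcClassIISections` step, next file of this lane); the OPEN
bracket `(x₁, x₂)` is the add-on via `SkewCutGalerkinTailForm.not_eigenvalue_of_structure`.

Proof: `H = lp (fun _ : Idx => ℂ) 2` with its canonical Hilbert basis; levels `ℓ_i = −|O_i|²/R` (→ −∞ cofinitely,
`AbcClassIIIndex.tendsto_levels`); free resolvent `d_i = (x₀ − ℓ_i)⁻¹` (`exists_resolventSymbol`);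
matrix `t_ij = amat_ij d_j`, banded (`amat_eq_zero_of_not_mem`, width `288²`), first order
(`abs_amat_le`, `K = 2592√R`), comparable weights (`one_add_onormSq_le_of_mem_nbrIdx`), Schur sums
automatic (`schur_data_of_band` with `x₀ = (WK)² + 2`); the abstract theorem gives `λ ∈ [x₁, x₂]` and
square-summable coordinates with all weighted moments finite solving the coordinate eigen-equation;
`AbcClassIISynthesis` turns them into a rapidly decaying, transversal, non-zero Cartesian family solving
the certifiers' eigen-equation at every frequency; `isLinNSEigenvalue_abcFlow_of_certifier_eigen`
(instab4 g5) concludes. Mathlib + the files named; no new definitions.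
-/

noncomputable section

open scoped BigOperators ComplexConjugate InnerProductSpace
open Finset MeasureTheory UnitAddTorus Filter Topology

namespace Summit.NavierStokesRegularity.FluidComputer.AbcClassII

open Literature.Analysis.FunctionSpaces Literature.Analysis.FunctionSpaces.Torus
open Literature.Analysis.FunctionSpaces.EuclideanSpace
open Literature.Analysis.FluidPDE Literature.Analysis.FluidPDE.SteadyLattice
open Literature.Analysis.FluidPDE.ScalarFourier

/-- **END-TO-END (closed bracket, section-eigenpair inputs).** See the module docstring. -/
theorem isLinNSEigenvalue_of_section_eigenpairs {R : ℝ} (hR : 1 ≤ R) (K₀ : ℕ) {x₁ x₂ : ℝ}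
    (v : ℕ → Idx → ℝ) (xs : ℕ → ℝ) (hxs : ∀ n, xs n ∈ Set.Icc x₁ x₂)
    (heig : ∀ n, ∀ i ∈ cubeIdx (K₀ + n),
      -(onormSq i.1 / R) * v n i + ∑ j ∈ cubeIdx (K₀ + n), amat i j * v n j = xs n * v n i)
    (hnorm : ∀ n, ∑ j ∈ cubeIdx (K₀ + n), v n j ^ 2 = 1) {C : ℝ} (hC : 0 ≤ C)
    (hgraph : ∀ n, ∑ j ∈ cubeIdx (K₀ + n), (1 + onormSq j.1 / R) ^ 2 * v n j ^ 2 ≤ C ^ 2) :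
    ∃ lam ∈ Set.Icc x₁ x₂,
      Torus.IsLinNSEigenvalue (1 / (2 * Real.pi * R)) (Torus.abcFlow 1 1 1) ((2 * Real.pi * lam : ℝ) : ℂ) := by
  classical
  have hR0 : 0 < R := by linarith
  -- the Hilbert space ℓ²(Idx) with its canonical basis
  let b : HilbertBasis Idx ℂ (lp (fun _ : Idx => ℂ) 2) := ⟨LinearIsometryEquiv.refl ℂ _⟩
  have hb : ∀ (z : lp (fun _ : Idx => ℂ) 2) (i : Idx), ⟪b i, z⟫_ℂ = z i := fun z i => by
    rw [← b.repr_apply_apply]; rfl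
  -- levels
  set ℓ : Idx → ℝ := fun i => -(onormSq i.1 / R) with hℓ
  have hℓ0 : ∀ i, ℓ i ≤ 0 := fun i => neg_nonpos.mpr (div_nonneg (onormSq_nonneg _) hR0.le)
  have hℓt : Tendsto ℓ cofinite atBot := tendsto_levels hR0
  -- constants and the base point
  set Kc : ℝ := 2592 * Real.sqrt R with hKc
  have hKc0 : 0 ≤ Kc := by positivity
  set P : ℝ := ((288 * 288 : ℕ) : ℝ) * Kc with hP
  have hP0 : 0 ≤ P := by positivity
  set x₀ : ℝ := P ^ 2 + 2 with hx₀
  have hx₀1 : 1 ≤ x₀ := by nlinarith [sq_nonneg P]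
  have hx₀0 : 0 < x₀ := by linarith
  -- the resolvent symbol and the weights
  obtain ⟨d, hdform, hd, hd0, hw0, hwℓ, -⟩ :=
    SkewCutGalerkinWeights.exists_resolventSymbol (𝕜 := ℂ) ℓ hℓ0 hℓt x₀ hx₀1
  have hwgt : ∀ i, Real.sqrt (1 + |ℓ i|) = Real.sqrt (1 + onormSq i.1 / R) := fun i => by
    simp only [hℓ]; rw [abs_neg, abs_of_nonneg (div_nonneg (onormSq_nonneg _) hR0.le)]
  -- the matrix of the relative bound
  set t : Idx → Idx → ℂ := fun i j => ((amat i j : ℝ) : ℂ) * d j with ht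
  have htx : ∀ i j, t i j * ((x₀ : ℂ) - (ℓ j : ℂ)) = ((amat i j : ℝ) : ℂ) := fun i j => by
    have h := hd j
    change ((amat i j : ℝ) : ℂ) * d j * ((x₀ : ℂ) - (ℓ j : ℂ)) = ((amat i j : ℝ) : ℂ)
    linear_combination ((amat i j : ℝ) : ℂ) * h
  have ht0 : ∀ i j, j ∉ nbrIdx i → t i j = 0 := fun i j hj => by
    change ((amat i j : ℝ) : ℂ) * d j = 0
    rw [amat_eq_zero_of_not_mem hj]; simp
  -- first-order growth
  have hgrow : ∀ j : Idx, 2592 * Real.sqrt (1 + onormSq j.1) ≤ Kc * Real.sqrt (1 + onormSq j.1 / R) := by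
    intro j
    rw [hKc, mul_assoc, ← Real.sqrt_mul hR0.le]
    refine mul_le_mul_of_nonneg_left (Real.sqrt_le_sqrt ?_) (by norm_num)
    rw [mul_add, mul_one, mul_div_cancel₀ _ hR0.ne']
    linarith [onormSq_nonneg j.1]
  have ha : ∀ i j, j ∈ nbrIdx i → ‖t i j * ((x₀ : ℂ) - (ℓ j : ℂ))‖ ≤ Kc * Real.sqrt (1 + |ℓ j|) := by
    intro i j _
    rw [htx, Complex.norm_real, Real.norm_eq_abs, hwgt]
    exact (abs_amat_le i j).trans (hgrow j)
  -- comparable weights along the band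
  have hL : ∀ i j, j ∈ nbrIdx i → Real.sqrt (1 + |ℓ i|) ≤ Real.sqrt (2 * (1 + R⁻¹)) * Real.sqrt (1 + |ℓ j|) := by
    intro i j hj
    rw [hwgt, hwgt, ← Real.sqrt_mul (by positivity)]
    exact Real.sqrt_le_sqrt (one_add_onormSq_le_of_mem_nbrIdx hR0 hj)
  -- the resolvent gains what the weight costs
  have hM : ∀ i, ‖d i‖ * Real.sqrt (1 + |ℓ i|) ≤ 1 / Real.sqrt x₀ := by
    intro i
    have e : ‖d i‖ = (x₀ - ℓ i)⁻¹ := by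
      rw [hdform i, RCLike.norm_ofReal, abs_of_nonneg (inv_nonneg.mpr (by linarith [hℓ0 i]))]
    rw [e]; exact SkewCutGalerkinLattice.weight_mul_symbol_le (hℓ0 i) hx₀1
  -- Schur data
  have hsymm : ∀ i j : Idx, j ∈ nbrIdx i ↔ i ∈ nbrIdx j := mem_nbrIdx_comm
  have hWcard : ∀ i : Idx, (nbrIdx i).card ≤ 288 * 288 := card_nbrIdx_le
  have hq : ((288 * 288 : ℕ) : ℝ) * Kc * (1 / Real.sqrt x₀) < 1 := by
    rw [← hP, mul_one_div, div_lt_one (Real.sqrt_pos.mpr hx₀0), Real.lt_sqrt hP0, hx₀]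
    linarith
  obtain ⟨hrow, hRle, hcol, hCle, hR00, hprod⟩ :=
    SkewCutGalerkinLattice.schur_data_of_band t ℓ x₀ (fun i => d i) hd nbrIdx hsymm hWcard ht0
      (fun i => Real.sqrt (1 + |ℓ i|)) hKc0 (by positivity) ha hM hq
  -- the sections and their eigenpairs
  set F : ℕ → Finset Idx := fun n => cubeIdx (K₀ + n) with hFdef
  have hF : Monotone F := fun m n h => cubeIdx_mono (Nat.add_le_add_left h K₀)
  have hFex : ∀ i, ∃ n, i ∈ F n := fun i => ⟨osupNorm i.1, mem_cubeIdx.mpr (Nat.le_add_left _ _)⟩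
  set c : ℕ → Idx → ℂ := fun n i => ((v n i : ℝ) : ℂ) with hcdef
  have heig' : ∀ n, ∀ i ∈ F n, (ℓ i : ℂ) * c n i +
      ∑ j ∈ F n, (t i j * ((x₀ : ℂ) - (ℓ j : ℂ))) * c n j = (xs n : ℂ) * c n i := by
    intro n i hi
    simp_rw [htx]
    have h := congrArg (fun r : ℝ => (r : ℂ)) (heig n i hi)
    push_cast at h
    change (((-(onormSq i.1 / R)) : ℝ) : ℂ) * ((v n i : ℝ) : ℂ) +
      ∑ j ∈ cubeIdx (K₀ + n), ((amat i j : ℝ) : ℂ) * ((v n j : ℝ) : ℂ) = ((xs n : ℝ) : ℂ) * ((v n i : ℝ) : ℂ)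
    push_cast
    linear_combination h
  have hnorm' : ∀ n, ∑ j ∈ F n, ‖c n j‖ ^ 2 = 1 := by
    intro n
    change ∑ j ∈ cubeIdx (K₀ + n), ‖((v n j : ℝ) : ℂ)‖ ^ 2 = 1
    simp only [Complex.norm_real, Real.norm_eq_abs, sq_abs]
    exact hnorm n
  have hgraph' : ∀ n, ∑ j ∈ F n, ‖((x₀ : ℂ) - (ℓ j : ℂ)) * c n j‖ ^ 2 ≤ (x₀ * C) ^ 2 := by
    intro n
    have hterm : ∀ j : Idx, ‖((x₀ : ℂ) - (ℓ j : ℂ)) * c n j‖ ^ 2 ≤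
        x₀ ^ 2 * ((1 + onormSq j.1 / R) ^ 2 * v n j ^ 2) := by
      intro j
      have e : ‖((x₀ : ℂ) - (ℓ j : ℂ)) * c n j‖ = (x₀ + onormSq j.1 / R) * |v n j| := by
        change ‖((x₀ : ℂ) - (((-(onormSq j.1 / R)) : ℝ) : ℂ)) * ((v n j : ℝ) : ℂ)‖ = _
        rw [norm_mul, Complex.norm_real, Real.norm_eq_abs,
          show ((x₀ : ℂ) - (((-(onormSq j.1 / R)) : ℝ) : ℂ)) = ((x₀ + onormSq j.1 / R : ℝ) : ℂ) by push_cast; ring,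
          Complex.norm_real, Real.norm_eq_abs, abs_of_nonneg (by linarith [div_nonneg (onormSq_nonneg j.1) hR0.le])]
      rw [e, mul_pow, sq_abs]
      have hκ : 0 ≤ onormSq j.1 / R := div_nonneg (onormSq_nonneg j.1) hR0.le
      have h1 : x₀ + onormSq j.1 / R ≤ x₀ * (1 + onormSq j.1 / R) := by nlinarith
      have h2 : (x₀ + onormSq j.1 / R) ^ 2 ≤ (x₀ * (1 + onormSq j.1 / R)) ^ 2 :=
        pow_le_pow_left₀ (by linarith) h1 2
      nlinarith [sq_nonneg (v n j)]
    calc ∑ j ∈ F n, ‖((x₀ : ℂ) - (ℓ j : ℂ)) * c n j‖ ^ 2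
        ≤ ∑ j ∈ F n, x₀ ^ 2 * ((1 + onormSq j.1 / R) ^ 2 * v n j ^ 2) := Finset.sum_le_sum fun j _ => hterm j
      _ = x₀ ^ 2 * ∑ j ∈ F n, (1 + onormSq j.1 / R) ^ 2 * v n j ^ 2 := by rw [Finset.mul_sum]
      _ ≤ x₀ ^ 2 * C ^ 2 := mul_le_mul_of_nonneg_left (hgraph n) (sq_nonneg _)
      _ = (x₀ * C) ^ 2 := by ring
  -- the abstract chain (closed bracket)
  obtain ⟨T, -, -, lam, hlam, w, hw1, hcoordw, hreg⟩ :=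
    SkewCutGalerkinFromSectionsIcc.exists_smooth_eigenvector_Icc_of_sections b ℓ x₀ d hd hd0 t hrow hRle
      hcol hCle hR00 hR00 hprod nbrIdx hsymm hWcard ht0 (fun i => Real.sqrt (1 + |ℓ i|)) hw0 hwℓ hKc0 ha
      (by positivity) hL hM F hF hFex c xs hxs heig' hnorm' (by positivity) hgraph'
  -- the coordinates
  set wc : Idx → ℂ := fun i => ⟪b i, w⟫_ℂ with hwc
  have hcoord : ∀ i : Idx, ((-(onormSq i.1 / R) : ℝ) : ℂ) * wc i +
      ∑ j ∈ nbrIdx i, ((amat i j : ℝ) : ℂ) * wc j = (lam : ℂ) * wc i := by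
    intro i
    have hs : ∑ j ∈ nbrIdx i, (t i j * ((x₀ : ℂ) - (ℓ j : ℂ))) * wc j =
        ∑ j ∈ nbrIdx i, ((amat i j : ℝ) : ℂ) * wc j :=
      Finset.sum_congr rfl fun j _ => by rw [htx]
    rw [← hs]
    exact hcoordw i
  -- the synthesised family
  let cf : Fam := fun k => if hk : k = 0 then 0 else
    ∑ a : Fin (odim (toOrbit k hk)), wc ⟨toOrbit k hk, a⟩ • bfam ⟨toOrbit k hk, a⟩ k
  have hcf0 : cf 0 = 0 := by simp [cf]
  have hcf : ∀ O : Orbit, ∀ k ∈ O.1, cf k = ∑ a : Fin (odim O), wc ⟨O, a⟩ • bfam ⟨O, a⟩ k := by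
    intro O k hk
    have hk0 : k ≠ 0 := O.ne_zero_of_mem hk
    have hO : toOrbit k hk0 = O := (toOrbit_eq_iff hk0 O).mpr hk
    subst hO
    simp only [cf, dif_neg hk0]
  -- weighted summability of the coordinates
  have hwsum : ∀ s : ℕ, Summable fun i : Idx => (1 + onormSq i.1) ^ s * ‖wc i‖ ^ 2 := by
    intro s
    refine Summable.of_nonneg_of_le (fun i => mul_nonneg (pow_nonneg (by linarith [onormSq_nonneg i.1]) _)
      (sq_nonneg _)) (fun i => ?_) ((hreg s).mul_left (R ^ s))
    have h1 : 1 + onormSq i.1 ≤ R * Real.sqrt (1 + |ℓ i|) ^ 2 := by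
      rw [hwgt, Real.sq_sqrt (by linarith [div_nonneg (onormSq_nonneg i.1) hR0.le]), mul_add, mul_one,
        mul_div_cancel₀ _ hR0.ne']
      linarith [onormSq_nonneg i.1]
    have h2 : (1 + onormSq i.1) ^ s ≤ (R * Real.sqrt (1 + |ℓ i|) ^ 2) ^ s :=
      pow_le_pow_left₀ (by linarith [onormSq_nonneg i.1]) h1 s
    calc (1 + onormSq i.1) ^ s * ‖wc i‖ ^ 2 ≤ (R * Real.sqrt (1 + |ℓ i|) ^ 2) ^ s * ‖wc i‖ ^ 2 :=
          mul_le_mul_of_nonneg_right h2 (sq_nonneg _)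
      _ = R ^ s * (Real.sqrt (1 + |ℓ i|) ^ (2 * s) * ‖⟪b i, w⟫_ℂ‖ ^ 2) := by
          rw [mul_pow, ← pow_mul]; ring
  -- properties of the synthesised family
  have hdecay : RapidDecay cf := rapidDecay_of_coordinates cf wc hcf hcf0 hwsum
  have hct := kdot_of_coordinates cf wc hcf hcf0
  have hne : cf ≠ 0 := by
    have hw0 : w ≠ 0 := by
      intro h; rw [h, norm_zero] at hw1; exact zero_ne_one hw1
    obtain ⟨i, hi⟩ : ∃ i, wc i ≠ 0 := by
      by_contra hall
      push Not at hall
      apply hw0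
      apply lp.ext
      funext i
      have := hall i
      rw [hwc] at this
      simp only [hb] at this
      simpa using this
    exact ne_zero_of_coordinates cf wc hcf hi
  have heq := certifier_eigen_of_coordinates (R := R) (lam : ℂ) cf wc hcf hcf0 hcoord
  refine ⟨lam, hlam, ?_⟩
  have h := AbcLatticeEigenSynthesis.isLinNSEigenvalue_abcFlow_of_certifier_eigen 1 1 1 hR0 (lam : ℂ)
    hdecay hct hcf0 hne (fun k => heq k)
  have e : ((2 * Real.pi * lam : ℝ) : ℂ) = 2 * Real.pi * (lam : ℂ) := by push_cast; ring
  rw [e]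
  exact h

end Summit.NavierStokesRegularity.FluidComputer.AbcClassII

end
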